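import Mathlib.Combinatorics.SimpleGraph.Hasse
import Mathlib.Combinatorics.SimpleGraph.Finite
import Mathlib.Combinatorics.SimpleGraph.Connectivity.Connected
import Mathlib.Combinatorics.SimpleGraph.Circulant
import Mathlib.Data.Int.SuccPred
import Mathlib.Algebra.Order.SuccPred
import Mathlib.Algebra.Group.Pi.Lemmas
import Mathlib.Algebra.Order.BigOperators.Group.Finset
import Mathlib.Data.Finset.Sym
import Mathlib.Data.ZMod.Basic
import Mathlib.Analysis.Complex.Basic
import HarnessLib

-- provenance: harness21/H21/H21/Prelude/StatMech/LatticeGraph.lean @ d5a5604 (interim HEAD d8f2665); M5 mechanical rewrite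
/-!
# The hypercubic lattice `ℤ^d` as a simple graph, tori, and finite-volume boundaries

This file provides the shared lattice bookkeeping for the lattice models of this library:

* `Site d := Fin d → ℤ`, the vertex set of `ℤ^d`. Its norm is Mathlib's Pi (sup) norm `‖x‖`
  (no separate Euclidean norm is introduced); `Site.toComplex` embeds `ℤ²` in `ℂ`;
  `Site.shift v` is translation by `v` (Mathlib's `Equiv.addRight`).
* `zdGraph d`, the nearest-neighbour graph on `ℤ^d`. **Design choice:** this *is* Mathlib's Hasse
  diagram `SimpleGraph.hasse (Fin d → ℤ)` of the product partial order: by `Pi.covBy_iff` and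
  `Order.covBy_iff_add_one_eq` (ℤ is a `SuccAddOrder`), `x ⋖ y` in `Fin d → ℤ` iff `y = x + eᵢ` for
  some coordinate vector `eᵢ = Pi.single i 1`. This is proved here (`Site.covBy_iff`,
  `zdGraph_adj_iff`), and the `DecidableRel`/`LocallyFinite` instances rest on that real proof.
* `TorusSite d L := Fin d → ZMod L` and the discrete torus graph `torusGraph d L`, defined as
  Mathlib's `SimpleGraph.circulantGraph` with jump set `{eᵢ | i : Fin d}`, with the projection
  `Torus.proj` (`Torus` is not a type, so this is not dot notation).
* Generic finite-volume boundary operations for a locally finite simple graph `G` and a finite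
  vertex set `Λ`: `outerBoundary`, `innerBoundary`, `edgesIn`, `edgesTouching`, `edgeBoundary`,
  with membership lemmas. Conventions follow Friedli–Velenik, *Statistical Mechanics of Lattice
  Systems* (2017), Ch. 3, §3.1 (`∂ᵉˣΛ`, `∂ⁱⁿΛ`, edge sets `ℰ_Λ` and `ℰ_Λ^b`).

Mathlib anchors used rather than re-defined: `SimpleGraph.hasse`, `SimpleGraph.hasse_adj`,
`Pi.covBy_iff_exists_right_eq`, `Order.covBy_iff_add_one_eq`, `SimpleGraph.neighborFinset`,
`SimpleGraph.incidenceFinset`, `SimpleGraph.LocallyFinite`, `SimpleGraph.circulantGraph`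
(the torus graph is a circulant graph on the additive group `(ZMod L)^d`), `Equiv.addRight`,
`ZMod`. Mathlib has no vertex/edge boundary of a vertex set in a `SimpleGraph`
(only `SimpleGraph.interedges` between two finsets, as ordered pairs), hence the boundary
definitions below; all of them only assume `[DecidableEq V] [G.LocallyFinite]`.

Not to be confused with the discrete-torus site type
`Literature.MathematicalPhysics.QuantumFieldTheory.Site d L` of the lattice-gauge-theory files.
-/

namespace Literature.Probability.LatticeModels

open Finset

/-! ### Sites of `ℤ^d` -/

/-- A site of the hypercubic lattice `ℤ^d`, i.e. a function `Fin d → ℤ`. The norm `‖x‖` is the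
sup norm inherited from Mathlib's Pi normed group structure.
(Friedli–Velenik 2017, §3.1.) [cite: FriedliVelenikSMLS2017, §3.1] -/
abbrev Site (d : ℕ) : Type := Fin d → ℤ

namespace Site

/-- The embedding of the planar lattice `ℤ²` into the complex plane, `x ↦ x₀ + i x₁`.
(Chelkak–Smirnov 2012, §1; Friedli–Velenik 2017, §3.1.) [cite: ChelkakSmirnov2012Invent, §1] -/
def toComplex (x : Site 2) : ℂ := ⟨x 0, x 1⟩

/-- `Site.toComplex` in coordinates. (Friedli–Velenik 2017, §3.1.) [cite: FriedliVelenikSMLS2017, §3.1] -/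
@[simp] theorem toComplex_re (x : Site 2) : (toComplex x).re = x 0 := rfl

/-- `Site.toComplex` in coordinates. (Friedli–Velenik 2017, §3.1.) [cite: FriedliVelenikSMLS2017, §3.1] -/
@[simp] theorem toComplex_im (x : Site 2) : (toComplex x).im = x 1 := rfl

/-- Translation of `ℤ^d` by the vector `v`, `x ↦ x + v`, as a bijection (Mathlib's
`Equiv.addRight`). (Friedli–Velenik 2017, §3.1, translation invariance.) [cite: FriedliVelenikSMLS2017, §3.1 (translation invariance)] -/
def shift {d : ℕ} (v : Site d) : Site d ≃ Site d := Equiv.addRight v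

/-- `Site.shift v x = x + v`. (Friedli–Velenik 2017, §3.1.) [cite: FriedliVelenikSMLS2017, §3.1] -/
@[simp] theorem shift_apply {d : ℕ} (v x : Site d) : shift v x = x + v := rfl

/-- The inverse of translation by `v` is translation by `-v`. (Friedli–Velenik 2017, §3.1.) [cite: FriedliVelenikSMLS2017, §3.1] -/
@[simp] theorem shift_symm_apply {d : ℕ} (v x : Site d) : (shift v).symm x = x - v := by
  simp [shift, sub_eq_add_neg]

variable {d : ℕ}

/-- In the product order on `ℤ^d`, `y` covers `x` iff `y` is obtained from `x` by adding a unit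
coordinate vector. This is `Pi.covBy_iff` combined with `Order.covBy_iff_add_one_eq` for `ℤ`.
(Folklore; cf. Friedli–Velenik 2017, §3.1.) [cite: FriedliVelenikSMLS2017, §3.1] -/
theorem covBy_iff {x y : Site d} : x ⋖ y ↔ ∃ i, y = x + Pi.single i 1 := by
  rw [Pi.covBy_iff_exists_right_eq]
  constructor
  · rintro ⟨i, a, h, rfl⟩
    rw [Order.covBy_iff_add_one_eq] at h
    subst h
    refine ⟨i, funext fun j => ?_⟩
    rcases eq_or_ne j i with rfl | hj
    · simp
    · simp [hj]
  · rintro ⟨i, rfl⟩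
    refine ⟨i, x i + 1, Order.covBy_iff_add_one_eq.2 rfl, funext fun j => ?_⟩
    rcases eq_or_ne j i with rfl | hj
    · simp
    · simp [hj]

end Site

/-! ### The nearest-neighbour graph on `ℤ^d` -/

variable {d : ℕ}

/-- The nearest-neighbour graph on `ℤ^d`: `x ∼ y` iff `x` and `y` differ by a unit coordinate
vector. Defined as Mathlib's Hasse diagram of the product partial order on `Fin d → ℤ`
(see `zdGraph_adj_iff` for the equivalence). (Friedli–Velenik 2017, §3.1.) [cite: FriedliVelenikSMLS2017, §3.1] -/
noncomputable abbrev zdGraph (d : ℕ) : SimpleGraph (Site d) := SimpleGraph.hasse (Site d)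

/-- Adjacency in `ℤ^d`: `x ∼ y` iff `y = x + eᵢ` or `x = y + eᵢ` for some coordinate `i`.
(Friedli–Velenik 2017, §3.1.) [cite: FriedliVelenikSMLS2017, §3.1] -/
theorem zdGraph_adj_iff (x y : Site d) :
    (zdGraph d).Adj x y ↔ ∃ i, y = x + Pi.single i 1 ∨ x = y + Pi.single i 1 := by
  rw [SimpleGraph.hasse_adj, Site.covBy_iff, Site.covBy_iff, ← exists_or]

/-- Adjacency in `ℤ^d` is decidable (via `zdGraph_adj_iff`). (Friedli–Velenik 2017, §3.1.) [cite: FriedliVelenikSMLS2017, §3.1] -/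
instance : DecidableRel (zdGraph d).Adj := fun x y =>
  decidable_of_iff _ (zdGraph_adj_iff x y).symm

/-- `ℤ^d` is locally finite: the neighbours of `x` are among the `2d` points `x ± eᵢ`.
(Friedli–Velenik 2017, §3.1.) [cite: FriedliVelenikSMLS2017, §3.1] -/
instance : (zdGraph d).LocallyFinite := fun x =>
  Fintype.ofFinset
    (((univ : Finset (Fin d × Bool)).image fun p =>
        if p.2 then x + Pi.single p.1 1 else x - Pi.single p.1 1).filter
      fun y => (zdGraph d).Adj x y)
    (by
      intro y
      simp only [mem_filter, mem_image, mem_univ, true_and, SimpleGraph.mem_neighborSet,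
        and_iff_right_iff_imp]
      intro h
      obtain ⟨i, h | h⟩ := (zdGraph_adj_iff x y).1 h
      · exact ⟨(i, true), by simp [h]⟩
      · exact ⟨(i, false), by simp [h]⟩)

/-- Adjacency in `ℤ^d` iff the `ℓ¹`-distance is `1`. (Friedli–Velenik 2017, §3.1:
`i ∼ j ⇔ ‖i - j‖₁ = 1`.) [cite: FriedliVelenikSMLS2017, §3.1 (i ∼ j iff ‖i - j‖₁ = 1)] -/
def zdGraph_adj_iff_norm : Prop :=
  ∀ (x y : Site d),
    (zdGraph d).Adj x y ↔ ∑ i, |x i - y i| = 1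

/-- Every site of `ℤ^d` has exactly `2d` neighbours. (Friedli–Velenik 2017, §3.1.) [cite: FriedliVelenikSMLS2017, §3.1] -/
def card_neighborFinset_zdGraph : Prop :=
  ∀ (x : Site d),
    #((zdGraph d).neighborFinset x) = 2 * d

/-- `ℤ^d` is (pre)connected. (Friedli–Velenik 2017, §3.1; cf. Mathlib's
`SimpleGraph.hasse_preconnected_of_succ` for `d = 1`.) [cite: FriedliVelenikSMLS2017, §3.1] -/
def zdGraph_preconnected : Prop :=
  (zdGraph d).Preconnected

/-- The nearest-neighbour graph is translation invariant. (Friedli–Velenik 2017, §3.1.)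
Not a `simp` lemma: `zdGraph` is reducible, so `simp` unfolds adjacency via `SimpleGraph.hasse_adj`
first. [cite: FriedliVelenikSMLS2017, §3.1] -/
theorem zdGraph_adj_shift_iff (v x y : Site d) :
    (zdGraph d).Adj (Site.shift v x) (Site.shift v y) ↔ (zdGraph d).Adj x y := by
  simp only [zdGraph_adj_iff, Site.shift_apply, add_right_comm _ v, add_left_inj]

/-! ### The discrete torus -/

/-- A site of the discrete torus `(ℤ/Lℤ)^d`. (Friedli–Velenik 2017, §3.1, periodic boundary
condition.) For `L = 0` this is `ℤ^d` again (`ZMod 0 = ℤ`).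
[cite: FriedliVelenikSMLS2017, §3.1 Definition 3.2 (periodic boundary condition)] -/
abbrev TorusSite (d L : ℕ) : Type := Fin d → ZMod L

/-- The nearest-neighbour graph on the discrete torus `(ℤ/Lℤ)^d`: `x ∼ y` iff `x ≠ y` and
`y = x ± eᵢ` for some `i`. For `L ≤ 2` the two directions `± eᵢ` coincide (and for `L = 1` the
graph is empty), so this is a *simple* graph without the multi-edges of the `L = 2` torus.
No `NeZero L` hypothesis is needed for the definition; finiteness statements assume it.
This is Mathlib's circulant graph on `(ZMod L)^d` with jumps `{eᵢ | i}`.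
(Friedli–Velenik 2017, §3.1.) [cite: FriedliVelenikSMLS2017, §3.1] -/
def torusGraph (d L : ℕ) : SimpleGraph (TorusSite d L) :=
  SimpleGraph.circulantGraph (Set.range fun i : Fin d => (Pi.single i 1 : TorusSite d L))

/-- Adjacency on the discrete torus, unfolded. (Friedli–Velenik 2017, §3.1.) [cite: FriedliVelenikSMLS2017, §3.1] -/
theorem torusGraph_adj_iff {L : ℕ} (x y : TorusSite d L) :
    (torusGraph d L).Adj x y ↔
      x ≠ y ∧ ((∃ i, y = x + Pi.single i 1) ∨ ∃ i, x = y + Pi.single i 1) := by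
  simp only [torusGraph, SimpleGraph.circulantGraph_adj, Set.mem_range]
  refine and_congr_right fun _ => ?_
  rw [or_comm]
  refine or_congr (exists_congr fun i => ?_) (exists_congr fun i => ?_)
  · rw [eq_sub_iff_add_eq', eq_comm]
  · rw [eq_sub_iff_add_eq', eq_comm]

/-- Adjacency on the discrete torus is decidable (Mathlib's instance for `circulantGraph` needs
decidable membership in the jump set, which is not available for `Set.range`).
(Friedli–Velenik 2017, §3.1.) [cite: FriedliVelenikSMLS2017, §3.1] -/
instance {L : ℕ} : DecidableRel (torusGraph d L).Adj := fun x y =>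
  decidable_of_iff _ (torusGraph_adj_iff x y).symm

/-- For `L ≠ 0` the torus graph is locally finite; this is Mathlib's instance for finite vertex
types with decidable adjacency (recorded as an `example`, not a new instance). -/
example {L : ℕ} [NeZero L] : (torusGraph d L).LocallyFinite := inferInstance

/-- The canonical projection `ℤ^d → (ℤ/Lℤ)^d`, coordinatewise reduction mod `L`.
(Friedli–Velenik 2017, §3.1.) [cite: FriedliVelenikSMLS2017, §3.1] -/
def Torus.proj (L : ℕ) (x : Site d) : TorusSite d L := fun i => (x i : ZMod L)

/-- `Torus.proj` in coordinates. (Friedli–Velenik 2017, §3.1.) [cite: FriedliVelenikSMLS2017, §3.1] -/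
@[simp] theorem Torus.proj_apply (L : ℕ) (x : Site d) (i : Fin d) :
    Torus.proj L x i = (x i : ZMod L) := rfl

/-! ### Finite-volume boundaries in a locally finite graph -/

section Boundary

variable {V : Type*} (G : SimpleGraph V)

/-- The outer (exterior) vertex boundary `∂ᵉˣΛ` of a finite vertex set `Λ`: the vertices outside
`Λ` adjacent to some vertex of `Λ`. (Friedli–Velenik 2017, §3.6.3, `∂ᵉˣΔ`, after (3.26).)
[cite: FriedliVelenikSMLS2017, §3.6.3 (exterior boundary, after (3.26))] -/
def outerBoundary [DecidableEq V] [G.LocallyFinite] (Λ : Finset V) : Finset V :=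
  (Λ.biUnion fun x => G.neighborFinset x) \ Λ

/-- The inner (interior) vertex boundary `∂ⁱⁿΛ`: the vertices of `Λ` adjacent to some vertex
outside `Λ`. (Friedli–Velenik 2017, §3.2.1, `∂ⁱⁿΛ`, after (3.3).) [cite: FriedliVelenikSMLS2017, §3.2.1 (interior boundary, after (3.3))] -/
def innerBoundary [DecidableEq V] [G.LocallyFinite] (Λ : Finset V) : Finset V :=
  Λ.filter fun x => ∃ y ∈ G.neighborFinset x, y ∉ Λ

/-- The edges of `G` with at least one endpoint in `Λ` (Friedli–Velenik 2017, §3.1, `ℰ_Λ^b`,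
used for non-free boundary conditions). [cite: FriedliVelenikSMLS2017, §3.1 (the edge set ℰ_Λ^b)] -/
def edgesTouching [DecidableEq V] [G.LocallyFinite] (Λ : Finset V) : Finset (Sym2 V) :=
  Λ.biUnion fun x => G.incidenceFinset x

/-- The edges of `G` with both endpoints in `Λ` (Friedli–Velenik 2017, §3.1, `ℰ_Λ`, free
boundary condition), as the sub-finset of `edgesTouching G Λ` of edges lying in `Λ.sym2`
(this phrasing keeps the instance requirements at `[DecidableEq V] [G.LocallyFinite]`). [cite: FriedliVelenikSMLS2017, §3.1 (the edge set ℰ_Λ, free boundary condition)] -/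
def edgesIn [DecidableEq V] [G.LocallyFinite] (Λ : Finset V) : Finset (Sym2 V) :=
  (edgesTouching G Λ).filter fun e => e ∈ Λ.sym2

/-- The edge boundary of `Λ`: edges of `G` with exactly one endpoint in `Λ`, i.e.
`edgesTouching G Λ \ edgesIn G Λ`. (Friedli–Velenik 2017, §3.1.) [cite: FriedliVelenikSMLS2017, §3.1] -/
def edgeBoundary [DecidableEq V] [G.LocallyFinite] (Λ : Finset V) :
    Finset (Sym2 V) :=
  edgesTouching G Λ \ edgesIn G Λ

variable {G}

/-- Membership in the outer boundary. (Friedli–Velenik 2017, §3.1.) [cite: FriedliVelenikSMLS2017, §3.1] -/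
@[simp] theorem mem_outerBoundary_iff [DecidableEq V] [G.LocallyFinite] {Λ : Finset V} {x : V} :
    x ∈ outerBoundary G Λ ↔ x ∉ Λ ∧ ∃ y ∈ Λ, G.Adj x y := by
  simp only [outerBoundary, mem_sdiff, mem_biUnion, SimpleGraph.mem_neighborFinset]
  constructor
  · rintro ⟨⟨y, hy, h⟩, hx⟩
    exact ⟨hx, y, hy, h.symm⟩
  · rintro ⟨hx, y, hy, h⟩
    exact ⟨⟨y, hy, h.symm⟩, hx⟩

/-- Membership in the inner boundary. (Friedli–Velenik 2017, §3.1.) [cite: FriedliVelenikSMLS2017, §3.1] -/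
@[simp] theorem mem_innerBoundary_iff [DecidableEq V] [G.LocallyFinite] {Λ : Finset V} {x : V} :
    x ∈ innerBoundary G Λ ↔ x ∈ Λ ∧ ∃ y ∉ Λ, G.Adj x y := by
  simp only [innerBoundary, mem_filter, SimpleGraph.mem_neighborFinset]
  exact and_congr_right fun _ => ⟨fun ⟨y, h, hy⟩ => ⟨y, hy, h⟩, fun ⟨y, hy, h⟩ => ⟨y, h, hy⟩⟩

/-- Membership in `edgesTouching`: an edge of `G` with some endpoint in `Λ`.
(Friedli–Velenik 2017, §3.1.) [cite: FriedliVelenikSMLS2017, §3.1] -/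
@[simp] theorem mem_edgesTouching_iff [DecidableEq V] [G.LocallyFinite] {Λ : Finset V} {e : Sym2 V} :
    e ∈ edgesTouching G Λ ↔ e ∈ G.edgeSet ∧ ∃ x ∈ Λ, x ∈ e := by
  simp only [edgesTouching, mem_biUnion, SimpleGraph.mem_incidenceFinset,
    SimpleGraph.incidenceSet, Set.mem_setOf_eq]
  constructor
  · rintro ⟨x, hx, he, hxe⟩
    exact ⟨he, x, hx, hxe⟩
  · rintro ⟨he, x, hx, hxe⟩
    exact ⟨x, hx, he, hxe⟩

/-- Membership in `edgesIn`: an edge of `G` all of whose endpoints lie in `Λ`.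
(Friedli–Velenik 2017, §3.1.) [cite: FriedliVelenikSMLS2017, §3.1] -/
@[simp] theorem mem_edgesIn_iff [DecidableEq V] [G.LocallyFinite] {Λ : Finset V} {e : Sym2 V} :
    e ∈ edgesIn G Λ ↔ e ∈ G.edgeSet ∧ ∀ x ∈ e, x ∈ Λ := by
  simp only [edgesIn, mem_filter, mem_edgesTouching_iff, Finset.mem_sym2_iff, and_assoc,
    and_congr_right_iff]
  intro _
  refine ⟨fun h => h.2, fun h => ⟨?_, h⟩⟩
  induction e using Sym2.ind with
  | _ a b => exact ⟨a, h a (Sym2.mem_mk_left a b), Sym2.mem_mk_left a b⟩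

/-- Membership in the edge boundary: an edge of `G` with an endpoint in `Λ` and an endpoint
outside `Λ`. (Friedli–Velenik 2017, §3.1.) [cite: FriedliVelenikSMLS2017, §3.1] -/
@[simp] theorem mem_edgeBoundary_iff [DecidableEq V] [G.LocallyFinite]
    {Λ : Finset V} {e : Sym2 V} :
    e ∈ edgeBoundary G Λ ↔ e ∈ G.edgeSet ∧ (∃ x ∈ Λ, x ∈ e) ∧ ∃ x ∉ Λ, x ∈ e := by
  simp only [edgeBoundary, mem_sdiff, mem_edgesTouching_iff, mem_edgesIn_iff, not_and,
    not_forall]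
  constructor
  · rintro ⟨⟨he, hx⟩, h⟩
    obtain ⟨y, hy, hyΛ⟩ := h he
    exact ⟨he, hx, y, hyΛ, hy⟩
  · rintro ⟨he, hx, y, hyΛ, hy⟩
    exact ⟨⟨he, hx⟩, fun _ => ⟨y, hy, hyΛ⟩⟩

/-- `ℰ_Λ ⊆ ℰ_Λ^b`: an edge with both endpoints in `Λ` has an endpoint in `Λ`.
(Friedli–Velenik 2017, §3.1.) [cite: FriedliVelenikSMLS2017, §3.1] -/
theorem edgesIn_subset_edgesTouching [DecidableEq V] [G.LocallyFinite]
    (Λ : Finset V) : edgesIn G Λ ⊆ edgesTouching G Λ :=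
  Finset.filter_subset _ _

end Boundary

end Literature.Probability.LatticeModels

/-! ### `ℤ^d` is connected -/

namespace Literature.Probability.LatticeModels

variable {d : ℕ}

/-- One may walk along a coordinate axis: `x ↝ x + k eᵢ` in `ℤ^d`, for every `k : ℤ`
(steps `± eᵢ` are edges by `zdGraph_adj_iff`). [folklore] -/
theorem zdGraph_reachable_add_single (x : Site d) (i : Fin d) (k : ℤ) :
    (zdGraph d).Reachable x (x + Pi.single i k) := by
  induction k using Int.induction_on with
  | zero => simp
  | succ n ih =>
    refine ih.trans (SimpleGraph.Adj.reachable ?_)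
    rw [zdGraph_adj_iff]
    exact ⟨i, Or.inl (by rw [add_assoc, ← Pi.single_add])⟩
  | pred n ih =>
    refine ih.trans (SimpleGraph.Adj.reachable ?_)
    rw [zdGraph_adj_iff]
    refine ⟨i, Or.inr ?_⟩
    rw [add_assoc, ← Pi.single_add]
    congr 2
    ring

/-- Every site of `ℤ^d` is reachable from every other: write `y - x = Σᵢ (y - x)ᵢ eᵢ` and walk
along the axes one at a time. [folklore] -/
theorem zdGraph_reachable (x y : Site d) : (zdGraph d).Reachable x y := by
  classical
  suffices h : ∀ (s : Finset (Fin d)) (v : Site d),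
      (zdGraph d).Reachable x (x + ∑ i ∈ s, Pi.single i (v i)) by
    have := h Finset.univ (y - x)
    rwa [Finset.univ_sum_single, add_sub_cancel] at this
  intro s v
  induction s using Finset.induction_on with
  | empty => simp
  | insert a s ha ih =>
    have e : x + ∑ i ∈ insert a s, (Pi.single i (v i) : Site d) =
        (x + ∑ i ∈ s, (Pi.single i (v i) : Site d)) + Pi.single a (v a) := by
      rw [Finset.sum_insert ha]; abel
    rw [e]
    exact ih.trans (zdGraph_reachable_add_single _ a (v a))

/-- **Proof of `zdGraph_preconnected`**: `ℤ^d` is preconnected. (Friedli–Velenik 2017,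
§3.1.) [cite: FriedliVelenikSMLS2017, §3.1] -/
theorem zdGraph_preconnected_holds : zdGraph_preconnected (d := d) :=
  fun x y => zdGraph_reachable x y

end Literature.Probability.LatticeModels

/-! ### Every site of `ℤ^d` has exactly `2d` neighbours -/

namespace Literature.Probability.LatticeModels

open Finset

variable {d : ℕ}

/-- The `2d` signed unit coordinate vectors `± eᵢ` of `ℤ^d`, indexed by `Fin d × Bool`
(`(i, true) ↦ eᵢ`, `(i, false) ↦ -eᵢ`), are pairwise distinct. [folklore] -/
theorem single_signedUnit_injective :
    Function.Injective fun p : Fin d × Bool => (Pi.single p.1 (if p.2 then 1 else -1) : Site d) := by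
  rintro ⟨i, b⟩ ⟨j, c⟩ h
  have hi : (if b then (1 : ℤ) else -1) = (Pi.single j (if c then (1 : ℤ) else -1) : Site d) i := by
    simpa using congr_fun h i
  obtain rfl : i = j := by
    by_contra hij
    rw [Pi.single_eq_of_ne hij] at hi
    cases b <;> simp at hi
  rw [Pi.single_eq_same] at hi
  cases b <;> cases c <;> simp_all

/-- The neighbours of `x` in `ℤ^d` are exactly the `2d` points `x ± eᵢ`, `i = 1, …, d`.
(Friedli–Velenik 2017, §3.1, `i ∼ j ⇔ ‖i - j‖₁ = 1`; §2.1, eq. (2.1): "its 2d neighbors".)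
[cite: FriedliVelenikSMLS2017, §3.1] -/
theorem neighborFinset_zdGraph_eq_image (x : Site d) :
    (zdGraph d).neighborFinset x =
      (univ : Finset (Fin d × Bool)).image
        fun p => x + Pi.single p.1 (if p.2 then 1 else -1) := by
  ext y
  simp only [SimpleGraph.mem_neighborFinset, zdGraph_adj_iff, mem_image, mem_univ, true_and,
    Prod.exists, Bool.exists_bool, Bool.false_eq_true, if_false, if_true]
  constructor
  · rintro ⟨i, h | h⟩
    · exact ⟨i, Or.inr h.symm⟩
    · exact ⟨i, Or.inl (by rw [h, Pi.single_neg, add_neg_cancel_right])⟩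
  · rintro ⟨i, h | h⟩
    · exact ⟨i, Or.inr (by rw [← h, Pi.single_neg, neg_add_cancel_right])⟩
    · exact ⟨i, Or.inl h.symm⟩

/-- **Proof of `card_neighborFinset_zdGraph`**: every site of `ℤ^d` has exactly `2d`
neighbours, namely `x ± eᵢ` (`neighborFinset_zdGraph_eq_image`, an injective image of
`Fin d × Bool`). (Friedli–Velenik 2017, §3.1; §2.1, eq. (2.1), "its 2d neighbors"; App. B.13,
the simple random walk "jumps to any one of its 2d nearest neighbors".)
[cite: FriedliVelenikSMLS2017, §3.1] -/
theorem card_neighborFinset_zdGraph_holds : card_neighborFinset_zdGraph (d := d) := by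
  intro x
  have hf : Function.Injective
      fun p : Fin d × Bool => x + (Pi.single p.1 (if p.2 then 1 else -1) : Site d) :=
    fun p q h => single_signedUnit_injective (add_left_cancel h)
  rw [neighborFinset_zdGraph_eq_image, card_image_of_injective _ hf, card_univ, Fintype.card_prod,
    Fintype.card_fin, Fintype.card_bool, mul_comm]

end Literature.Probability.LatticeModels
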